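import Summits.BirchSwinnertonDyer.BirchSwinnertonDyer.Theorems.ErratumRoadFiveEulerHalfPotMultTwinDefs
import Summits.BirchSwinnertonDyer.BirchSwinnertonDyer.Theses.ErratumRoadFive
import HarnessLib

/-!
# The served-class target is a SUB-STATEMENT of crux 19715 (companion of
# `Theorems/ErratumRoadFiveEulerHalfPotMultTwinDefs.lean`; LEAD g7 spec bbb507f02f0120c2, theorem part)

`eulerHalfPOnlyMultPotMultTwinAtFive_of_crux`: the crux `Theses.ErratumRoadFive.EulerHalfNotRamNoInertSetAtFive`
(stmt-BirchSwinnertonDyer-19715) implies `EulerHalfPotMultTwin.EulerHalfPOnlyMultPotMultTwinAtFive` — a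
pair whose only multiplicative prime is `p` has no even set `S ∋ p` of multiplicative primes, so the crux's
«no inert-set datum» hypothesis holds (the served prime `q` is not even used). Hence the served-class item
lies inside 19715's cone and is closed by any proof of 19715; the converse fails on the potentially-good-only
complement (e.g. the rung (605a1, 5)). Kept OUT of the Defs module so that module stays importable from the
route file (no import cycle). THEOREM ONLY; no summit statement is touched; BSD is proved for no curve.
-/

set_option autoImplicit false
-- D-0017: single-problem summit, so `Summit.BirchSwinnertonDyer.BirchSwinnertonDyer.…` repeats a namespace BY DESIGN.
set_option linter.dupNamespace false

noncomputable section

open scoped Classical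

open WeierstrassCurve Literature.NumberTheory.EllipticCurves
  Literature.NumberTheory.EllipticCurves.Rank1Residual
  Literature.NumberTheory.EllipticCurves.Rank1Residual.Typed
  Summit.BirchSwinnertonDyer.Rank1Residual

namespace Summit.BirchSwinnertonDyer.BirchSwinnertonDyer.Theorems.EulerHalfPotMultTwin

/-- **The served-class target is a sub-statement of the crux `EulerHalfNotRamNoInertSetAtFive`**
(item stmt-BirchSwinnertonDyer-19715): when `p` is the only multiplicative prime, every finite set
`S ∋ p` of multiplicative primes is `{p}`, of odd cardinality, so the crux's «no inert-set datum»
hypothesis holds and the crux applies (the served prime `q` is not used). [folklore] -/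
theorem eulerHalfPOnlyMultPotMultTwinAtFive_of_crux
    (h : Summit.BirchSwinnertonDyer.BirchSwinnertonDyer.Theses.ErratumRoadFive.EulerHalfNotRamNoInertSetAtFive) :
    EulerHalfPOnlyMultPotMultTwinAtFive := by
  intro W _ _ p _ hX hp5 hρ hnram hc honly _ _ _
  refine h W p hX hp5 hρ hnram hc ?_
  rintro ⟨S, hSmult, hSeven, hpS, -, -⟩
  have hS : S = {p} := by
    refine Finset.Subset.antisymm ?_ (Finset.singleton_subset_iff.mpr hpS)
    intro ℓ hℓ
    obtain ⟨hℓp, hℓm⟩ := hSmult ℓ hℓ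
    exact Finset.mem_singleton.mpr (@honly ℓ hℓp hℓm)
  rw [hS, Finset.card_singleton] at hSeven
  exact Nat.not_even_one hSeven

end Summit.BirchSwinnertonDyer.BirchSwinnertonDyer.Theorems.EulerHalfPotMultTwin

end
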